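import Summits.QuantumFields.YangMills.Theorems.BalabanUVNodesN09ContourThresholdNull
import HarnessLib

/-!
# `BalabanUVNodes.N09AveragingAEContinuous` — THE BLOCK AVERAGING (0.4) OF RECORD IS `dU`-ALMOST-EVERYWHERE CONTINUOUS

Cell `pub-ymgap`, YM-PLAN Track A, DAG node N09 [Balaban1987RG1]; seat `pub-ymgap-dag-n09-w3` g3; rider to this seat's
`BalabanUVNodesN09ContourThresholdNull` (the guard spheres of (0.4) are `dU`-null).  `--kind proof --supports stmt-QuantumFields-20542 --as helper`
(K1⁷), COUNT-NEUTRAL.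

HONEST FRAMING.  Kernel topology ∕ measure bookkeeping on NODE 00's averaging of record, read BY NAME (`Node00.AveragingSmooth`: `coe_avgFun_of_small`,
`contDiffAt_corrM`, `contDiff_axialM`, `coe_axialAvg`; `Node00.DatumAvLayer.avOfRecord_avg`); NOTHING of Bałaban's analysis is asserted; no carrier
re-pointed; (F1) (the Jacobian face of (0.4)), (F3) and the FIBRE reading of (F2) untouched ⇒ N09's `hreg`∕`contTOn` stay DISPLAYED; N09 NOT
discharged; K0⁷∕K1⁷ NOT closed; counts unmoved (typed 28∕28 · discharged 5∕27); R4 = the conditional finite-𝕋⁴ rung `BalabanLadder.UV` only; the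
Yang–Mills mass gap (Clay) is NOT proved by any of this; nothing continuum ∕ ℝ⁴ ∕ OS.

THE POINT.  The total map `Ū = avgFun expMeanLogSU` (= `(avOfRecord F N K k).avg`, `rfl`) is NOT continuous: it switches from `exp[mean log]` of the
loop variables to the axial average across the guard spheres `dist1 (loopHol U c i) = δ_N` (`BlockAveragingExpMeanLogContinuous`, header;
`Node00.Record12MinimiserSelection.sigmaClosedContinuous_avgFun` records continuity on the two closed-cover pieces).  By
`…N09ContourThresholdNull.ae_forall_dist1_loopHol_ne` with `r := δ_N > 0` the guard spheres are `dU`-null; on the open guard `↑Ū(c) = avgM ↑U c`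
is `C^ω`, strictly off it `Ū(c)` is the continuous axial average; hence **`Ū` is continuous at `dU`-almost every configuration**, and the guard set
`{∀ c, Small U c}` is a `dU`-continuity set — the «(F2) for the guard spheres» line of `pub-ymgap-node00-def-K0e/P7-LOCATOR-AUDIT.md` §4 in full
product-Haar currency (the continuous-mapping ∕ Portmanteau input for push-forwards under `Ū`).

WHAT IS PROVED (theorems only; 0 definitions; 0 sorry; axioms standard).  `continuous_coeField`, `isOpen_setOf_small`, `continuous_axialAvg_apply`,
`continuousAt_avgFun_apply_of_small`, `continuousAt_avgFun_apply_of_lt`, `continuousAt_avgFun_of_forall_ne`, ★★ **`ae_continuousAt_avgFun`**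
(`dU`-a.e. `U`, `ContinuousAt (avgFun expMeanLogSU) U`, every `Params`, level, `N ≥ 1`), `fieldMeasure_frontier_setOf_forall_small_eq_zero`,
★★ **`ae_continuousAt_avOfRecord_avg`** (every torus `K` and level `k` of a `T4Family`); §2 `quasiMeasurePreserving_avOfRecord_avg` (`k < K`),
`quasiMeasurePreserving_iter_avOfRecord`, ★★★ **`ae_continuousAt_iter_avOfRecord`** (`k ≤ K` ⇒ `dU_0`-a.e. `U`, `ContinuousAt (Ū^k) U`, via the tree's
`HaarAC` bracket `Node00.avOfRecord_haarAC`).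

References: T. Bałaban, Commun. Math. Phys. **109** (1987) 249–301 [Balaban1987RG1] (0.4) p. 253; **98** (1985) 17–51 [Balaban1985Averaging] (10) p. 19;
Th. Bröcker, T. tom Dieck, GTM 98 (1985) [BrockerTomDieck1985] IV (2.11); B. S. Mityagin [Mityagin2015] Prop. 1.
-/

noncomputable section

open Set Function Filter Topology MeasureTheory
open scoped ENNReal NNReal Matrix.Norms.L2Operator

namespace Summit.QuantumFields.YangMills.BalabanUVNodes.N09AveragingAEContinuous

open Literature.MathematicalPhysics.QuantumFieldTheory
open Literature.MathematicalPhysics.QuantumFieldTheory.Balaban1983to89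
open T4Continuum BlockAveraging
open ExpMeanLog (expMeanLogSU deltaSU deltaSU_pos)
open Node00 (coeField coeField_apply corrM avgM axialM coe_avgFun_of_small coe_axialAvg contDiffAt_corrM contDiff_axialM
  norm_loopM_coeField_sub_one_lt_one avOfRecord avOfRecord_avg)
open N09ContourThresholdNull (continuous_dist1_holAt ae_forall_dist1_loopHol_ne
  fieldMeasure_frontier_setOf_forall_dist1_loopHol_lt_eq_zero)

section Averaging

variable {P : Params} {j : ℕ} {N : ℕ}

/-- The field of bond matrices depends continuously on the configuration. [cite: Balaban1987RG1, (0.1) p.251 (bookkeeping)] -/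
theorem continuous_coeField :
    Continuous (coeField : GaugeField P j (Matrix.specialUnitaryGroup (Fin N) ℂ) → PBond P j → Matrix (Fin N) (Fin N) ℂ) :=
  continuous_pi fun b => continuous_subtype_val.comp (continuous_apply b)

variable [NeZero N]

/-- **THE GUARD OF (0.4) AT A COARSE BOND IS OPEN**: `{U : Small U c}` (all loop variables at `c` within `δ_N` of `1`).
[cite: Balaban1987RG1, (0.4) p.253 (bookkeeping)] -/
theorem isOpen_setOf_small (c : PBond P (j + 1)) :
    IsOpen {U : GaugeField P j (Matrix.specialUnitaryGroup (Fin N) ℂ) | Small (expMeanLogSU (n := Fin N)) U c} := by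
  have hrepr : {U : GaugeField P j (Matrix.specialUnitaryGroup (Fin N) ℂ) | Small (expMeanLogSU (n := Fin N)) U c} =
      ⋂ i : Idx P, {U | dist1 (loopHol U c i) < (expMeanLogSU (n := Fin N)).δ} := by
    ext U; simp only [BlockAveraging.Small, Set.mem_setOf_eq, Set.mem_iInter]
  rw [hrepr]
  exact isOpen_iInter_of_finite fun i => isOpen_lt (continuous_dist1_holAt _) continuous_const

/-- The coarse bond variable of the AXIAL average is continuous in the fine configuration (the straight-segment matrix product).
[cite: Balaban1987RG1, (0.4) p.253 (bookkeeping)] -/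
theorem continuous_axialAvg_apply (c : PBond P (j + 1)) :
    Continuous fun U : GaugeField P j (Matrix.specialUnitaryGroup (Fin N) ℂ) => AveragingRT.axialAvg U c := by
  rw [Topology.IsInducing.subtypeVal.continuous_iff]
  exact ((contDiff_axialM c).continuous.comp continuous_coeField).congr fun U => (coe_axialAvg U c).symm

/-- **ON THE GUARD, `U ↦ Ū(c)` IS CONTINUOUS AT `U`**: there `↑Ū(c) = avgM ↑U c` on an open neighbourhood, and the matrix extension is `C^ω` at `↑U`
(`Node00.AveragingSmooth`). [cite: Balaban1987RG1, (0.4) p.253 («analytic function»)] -/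
theorem continuousAt_avgFun_apply_of_small {U : GaugeField P j (Matrix.specialUnitaryGroup (Fin N) ℂ)} (c : PBond P (j + 1))
    (h : Small (expMeanLogSU (n := Fin N)) U c) :
    ContinuousAt (fun V : GaugeField P j (Matrix.specialUnitaryGroup (Fin N) ℂ) => avgFun (expMeanLogSU (n := Fin N)) V c) U := by
  rw [Topology.IsInducing.subtypeVal.continuousAt_iff]
  have hmat : ContinuousAt (fun V : GaugeField P j (Matrix.specialUnitaryGroup (Fin N) ℂ) => avgM (coeField V) c) U := by
    have h1 : ContinuousAt (fun W : PBond P j → Matrix (Fin N) (Fin N) ℂ => corrM W c * axialM W c) (coeField U) :=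
      (contDiffAt_corrM c (norm_loopM_coeField_sub_one_lt_one U c h)).continuousAt.mul
        (contDiff_axialM c).continuous.continuousAt
    exact h1.comp continuous_coeField.continuousAt
  refine hmat.congr ?_
  filter_upwards [(isOpen_setOf_small c).mem_nhds h] with V hV
  exact (coe_avgFun_of_small V c hV).symm

/-- **STRICTLY OFF THE GUARD, `U ↦ Ū(c)` IS CONTINUOUS AT `U`**: if one loop variable at `c` is `> δ_N`, then `Ū(c)` is the axial average on an open
neighbourhood. [cite: Balaban1987RG1, (0.4) p.253 (bookkeeping)] -/
theorem continuousAt_avgFun_apply_of_lt {U : GaugeField P j (Matrix.specialUnitaryGroup (Fin N) ℂ)} (c : PBond P (j + 1)) (i : Idx P)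
    (h : (expMeanLogSU (n := Fin N)).δ < dist1 (loopHol U c i)) :
    ContinuousAt (fun V : GaugeField P j (Matrix.specialUnitaryGroup (Fin N) ℂ) => avgFun (expMeanLogSU (n := Fin N)) V c) U := by
  have hopen : IsOpen {V : GaugeField P j (Matrix.specialUnitaryGroup (Fin N) ℂ) |
      (expMeanLogSU (n := Fin N)).δ < dist1 (loopHol V c i)} :=
    isOpen_lt continuous_const (continuous_dist1_holAt _)
  refine (continuous_axialAvg_apply c).continuousAt.congr ?_
  filter_upwards [hopen.mem_nhds h] with V hV
  have hnot : ¬ Small (expMeanLogSU (n := Fin N)) V c := fun hs => lt_irrefl _ ((hs i).trans hV)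
  show AveragingRT.axialAvg V c = avgFun (expMeanLogSU (n := Fin N)) V c
  unfold avgFun corr
  rw [if_neg hnot, one_mul]

/-- **OFF THE GUARD SPHERES, `Ū` IS CONTINUOUS**: if no (0.4) loop variable of `U` sits exactly at `δ_N`, the block averaging is continuous at `U`
(coordinatewise: each coarse bond is either guarded or strictly unguarded near `U`). [cite: Balaban1987RG1, (0.4) p.253] -/
theorem continuousAt_avgFun_of_forall_ne {U : GaugeField P j (Matrix.specialUnitaryGroup (Fin N) ℂ)}
    (h : ∀ (c : PBond P (j + 1)) (i : Idx P), dist1 (loopHol U c i) ≠ (expMeanLogSU (n := Fin N)).δ) :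
    ContinuousAt (avgFun (expMeanLogSU (n := Fin N)) :
      GaugeField P j (Matrix.specialUnitaryGroup (Fin N) ℂ) → GaugeField P (j + 1) (Matrix.specialUnitaryGroup (Fin N) ℂ)) U := by
  refine continuousAt_pi.2 fun c => ?_
  by_cases hs : Small (expMeanLogSU (n := Fin N)) U c
  · exact continuousAt_avgFun_apply_of_small c hs
  · simp only [BlockAveraging.Small, not_forall, not_lt] at hs
    obtain ⟨i, hi⟩ := hs
    exact continuousAt_avgFun_apply_of_lt c i (lt_of_le_of_ne hi (h c i).symm)

/-- ★★ **THE BLOCK AVERAGING (0.4) WITH `exp[mean log]` ON `SU(N)` IS `dU`-ALMOST-EVERYWHERE CONTINUOUS** at every level of every torus: the guard spheres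
`{dist1 (loopHol U c i) = δ_N}` are `dU`-null (`…N09ContourThresholdNull` §2). [cite: Balaban1987RG1, (0.4) p.253] [cite: Balaban1985Averaging, (10) p.19]
[cite: BrockerTomDieck1985, IV (2.11) (proof)] [cite: Mityagin2015, Proposition 1] -/
theorem ae_continuousAt_avgFun :
    ∀ᵐ U ∂(fieldMeasure P j (Matrix.specialUnitaryGroup (Fin N) ℂ)),
      ContinuousAt (avgFun (expMeanLogSU (n := Fin N)) :
        GaugeField P j (Matrix.specialUnitaryGroup (Fin N) ℂ) → GaugeField P (j + 1) (Matrix.specialUnitaryGroup (Fin N) ℂ)) U := by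
  filter_upwards [ae_forall_dist1_loopHol_ne (P := P) (j := j) (N := N) (deltaSU_pos (n := Fin N)).ne'] with U hU
  exact continuousAt_avgFun_of_forall_ne hU

/-- **THE GUARD SET `{U : ∀ c, Small U c}` IS A `dU`-CONTINUITY SET** (open with `dU`-null frontier). [cite: Balaban1987RG1, (0.4) p.253]
[cite: Balaban1985Averaging, (10) p.19] [cite: BrockerTomDieck1985, IV (2.11) (proof)] -/
theorem fieldMeasure_frontier_setOf_forall_small_eq_zero :
    fieldMeasure P j (Matrix.specialUnitaryGroup (Fin N) ℂ)
      (frontier {U : GaugeField P j (Matrix.specialUnitaryGroup (Fin N) ℂ) |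
        ∀ c : PBond P (j + 1), Small (expMeanLogSU (n := Fin N)) U c}) = 0 :=
  fieldMeasure_frontier_setOf_forall_dist1_loopHol_lt_eq_zero (deltaSU_pos (n := Fin N)).ne'

variable {F : T4Family}

/-- ★★ **THE AVERAGING OF RECORD IS `dU`-ALMOST-EVERYWHERE CONTINUOUS**: `(avOfRecord F N K k).avg` is continuous at `dU`-a.e. configuration of level `k`
of the torus `K`, for every `K`, `k` (`avOfRecord_avg` is `rfl`). [cite: Balaban1987RG1, (0.4) p.253] [cite: Balaban1985Averaging, (10) p.19]
[cite: BrockerTomDieck1985, IV (2.11) (proof)] -/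
theorem ae_continuousAt_avOfRecord_avg (K k : ℕ) :
    ∀ᵐ U ∂(fieldMeasure (F.P K) k (Matrix.specialUnitaryGroup (Fin N) ℂ)), ContinuousAt (avOfRecord F N K k).avg U := by
  rw [avOfRecord_avg]
  exact ae_continuousAt_avgFun

end Averaging

/-! ## §2 The iterates `Ū^k = Averaging.iter (avOfRecord F N K) k` are `dU`-almost-everywhere continuous (`k ≤ K`) -/

section Iterates

variable {F : T4Family} {N : ℕ} [NeZero N]

open Node00 (avOfRecord_measurable avOfRecord_haarAC)

/-- Each averaging map of record is quasi-measure-preserving between the product Haar measures of consecutive levels (measurable + the tree's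
`HaarAC` bracket `avOfRecord_haarAC`, `k < K`). [cite: Balaban1985Averaging, (10) p.19] [cite: Balaban1987RG1, (0.4) p.253] -/
theorem quasiMeasurePreserving_avOfRecord_avg (K k : ℕ) (hk : k < K) :
    Measure.QuasiMeasurePreserving (avOfRecord F N K k).avg
      (fieldMeasure (F.P K) k (Matrix.specialUnitaryGroup (Fin N) ℂ))
      (fieldMeasure (F.P K) (k + 1) (Matrix.specialUnitaryGroup (Fin N) ℂ)) :=
  ⟨avOfRecord_measurable F N K k, avOfRecord_haarAC F N K k hk⟩

/-- **The iterate `Ū^k : SU(N)^{bonds_0} → SU(N)^{bonds_k}` is quasi-measure-preserving** (`dU_0 ∘ (Ū^k)⁻¹ ≪ dU_k`) for `k ≤ K` (composition).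
[cite: Balaban1987RG1, (0.11) p.253] [cite: Balaban1985Averaging, (10) p.19] -/
theorem quasiMeasurePreserving_iter_avOfRecord (K : ℕ) :
    ∀ k : ℕ, k ≤ K → Measure.QuasiMeasurePreserving (Averaging.iter (avOfRecord F N K) k)
      (fieldMeasure (F.P K) 0 (Matrix.specialUnitaryGroup (Fin N) ℂ))
      (fieldMeasure (F.P K) k (Matrix.specialUnitaryGroup (Fin N) ℂ))
  | 0, _ => Measure.QuasiMeasurePreserving.id _
  | k + 1, h => (quasiMeasurePreserving_avOfRecord_avg K k (by omega)).comp
      (quasiMeasurePreserving_iter_avOfRecord K k (by omega))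

/-- ★★★ **EVERY ITERATE `Ū^k` OF THE AVERAGING OF RECORD IS `dU`-ALMOST-EVERYWHERE CONTINUOUS ON THE FINEST LEVEL** (`k ≤ K`): by induction,
`Ū^{k+1} = Ū ∘ Ū^k`, with §1 at level `k` pulled back along the quasi-measure-preserving `Ū^k`.  The continuous-mapping input for every
push-forward `dU_0 ∘ (Ū^k)⁻¹` argument at the record. [cite: Balaban1987RG1, (0.11) p.253] [cite: Balaban1985Averaging, (10) p.19]
[cite: BrockerTomDieck1985, IV (2.11) (proof)] -/
theorem ae_continuousAt_iter_avOfRecord (K : ℕ) :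
    ∀ k : ℕ, k ≤ K → ∀ᵐ U ∂(fieldMeasure (F.P K) 0 (Matrix.specialUnitaryGroup (Fin N) ℂ)),
      ContinuousAt (Averaging.iter (avOfRecord F N K) k) U
  | 0, _ => Filter.Eventually.of_forall fun _ => continuousAt_id
  | k + 1, h => by
    have h1 := ae_continuousAt_iter_avOfRecord K k (by omega)
    have h2 : ∀ᵐ U ∂(fieldMeasure (F.P K) 0 (Matrix.specialUnitaryGroup (Fin N) ℂ)),
        ContinuousAt (avOfRecord F N K k).avg (Averaging.iter (avOfRecord F N K) k U) :=
      (quasiMeasurePreserving_iter_avOfRecord K k (by omega)).ae (ae_continuousAt_avOfRecord_avg K k)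
    filter_upwards [h1, h2] with U hU1 hU2
    exact ContinuousAt.comp hU2 hU1

end Iterates

end Summit.QuantumFields.YangMills.BalabanUVNodes.N09AveragingAEContinuous

end
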